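import Summits.QuantumAdvantage.AdviceFreeQNC0.WalkGapSqrtEngine
import HarnessLib

/-!
# Cell qa-qnc0 (odd primes `p ≥ 5`): rung R6 `WalkHardFShotsSqrt p` — the `√n`-SHOTS rung

Planner qa-qnc0-p2 g14, ROUND-14 §3 ("NEXT R6 = `WalkHardFShotsSqrt`: B²·polylog ≤ n; needs two new tree inputs": qn-lit
g16's promise-parity seed families — `TConstantProbDegree.lean`, STV21 Cor. 19 — and qn-prover g10's robust level-set
elimination `elimLevelSqrtF_robust` — `EliminationHardnessF.lean`).  Statement typed HERE (no planner text existed yet):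
**`WalkHardFShotsSqrt p`** = the body of `WalkHardFShots p` / route item `ShotsOdd` with the budget `B³(log₂n)^{2C+2} ≤ n`
replaced by **`B²·(log₂ n)^{2C+3} ≤ n`** (`B ≤ √n/polylog` shots per input, positions arbitrary and adaptive, potential
support dense).  PROVED here:

* **`walkHardFShotsSqrt_of_elimRobust p`** — from the `elimLevelSqrtF_robust`-shape hypothesis: surgery on a quiet
  interval of length `L = (B+1)(log₂ n)^{2C+1}` (`m = n/L ≥ B·log₂ n` intervals, one entered by `≤ (η₀/2)·2ⁿ` inputs);
  in each fibre ONE realisation of the three level sets of the named residue (`GapFibre.ufam_levelSets` +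
  `UFam.exists_realisation` on the fibre cube; error set `≤ 6ε·2^L ≤ ε₀·2^L`, `ε = min(ε₀/6, 2^{-101})`) has degree
  `6·stvDegree p (B+1) ε·(log₂ n)^C ≤ 6K√(B+1)(log₂ n)^C ≤ c₀√L` once `36K² ≤ c₀²·log₂ n`; robust elimination gives
  `≥ η₀·2^L` losses per fibre, `sum_fibre` adds them up; `θ = max(1 − η₀/2, 1/2)`.
* **`walkHardFShotsSqrt (p) (hp3 : p ≠ 3) : WalkHardFShotsSqrt p`** — UNCONDITIONAL for every prime `p ≠ 3`.

So the per-input-sparsity method reaches `B ≈ √n/polylog` shots per input, its ceiling (ROUND-14 §3: past `√n` the residual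
is genuinely dense).  WHAT THIS IS NOT: the dense residual `DenseResidualOdd` of route `OddPrimeWalk` is untouched (and is
not implied: its regime starts at `b³(log₂ n)^{2C+2} > n`); separation NOT moved.
-/

noncomputable section

namespace Summit.QuantumAdvantage.AdviceFreeQNC0

open Classical
open Finset
open Literature.Computability.MetaComplexity Literature.Computability.MetaComplexity.Smolensky
open Literature.Computability.Complexity

variable {n : ℕ}

/-! ### The `√n`-shots rung -/

/-- **`WalkHardFShotsSqrt p`** (rung R6, planner qa-qnc0-p2 ROUND-14 §3; typed here): the per-input-sparse rung in the
regime `B ≤ √n/polylog` — strategies of `𝔽_p`-degree `(log₂ n)^C` firing at most `B` cuts on every input, with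
`B²·(log₂ n)^{2C+3} ≤ n`, win α's u-walk game on at most `θ·2ⁿ` inputs, one `θ < 1` for all `C`. -/
def WalkHardFShotsSqrt (p : ℕ) [Fact p.Prime] : Prop :=
  ∃ θ : ℝ, θ < 1 ∧ ∀ C : ℕ, ∃ n₀ : ℕ, ∀ n ≥ n₀, ∀ c B : ℕ,
    ∀ y : Fin (n + 1) → (Fin n → Bool) → Bool,
      (∀ g, HasDegF p (y g) ((Nat.log 2 n) ^ C)) →
      (∀ u, (Finset.univ.filter fun g : Fin (n + 1) => y g u = true).card ≤ B) →
      B ^ 2 * (Nat.log 2 n) ^ (2 * C + 3) ≤ n →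
        ((Finset.univ.filter fun u : Fin n → Bool => ringWinU c y u = true).card : ℝ) ≤ θ * (2 : ℝ) ^ n

open GapFibre in
/-- **The `√n`-shots rung from ROBUST level-set elimination** (the `elimLevelSqrtF_robust`-shape hypothesis `hE`):
surgery on a quiet interval of length `L = (B+1)(log₂ n)^{2C+1}`; in each fibre the three level sets of the named residue
are realised, off an error set of `≤ 6ε·2^L` points, by ONE seed of the joined promise-parity seed family
(`GapFibre.ufam_levelSets`, degree `6·stvDegree p (B+1) ε·(log₂ n)^C ≤ 6K√(B+1)(log₂ n)^C ≤ c₀√L`); robust elimination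
on the `L`-cube then gives `≥ η₀·2^L` losses per fibre. -/
theorem walkHardFShotsSqrt_of_elimRobust (p : ℕ) [Fact p.Prime]
    (hE : ∃ η₀ : ℝ, 0 < η₀ ∧ ∃ ε₀ : ℝ, 0 < ε₀ ∧ ∃ c₀ : ℝ, 0 < c₀ ∧ ∃ n₀ : ℕ, ∀ n ≥ n₀, ∀ d : ℕ,
      (d : ℝ) ≤ c₀ * Real.sqrt n → ∀ e : (Fin n → Bool) → ℕ, ∀ X : Finset (Fin n → Bool),
        (X.card : ℝ) ≤ ε₀ * (2 : ℝ) ^ n →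
        (∀ r : ℕ, ∃ P : Smolensky.CubeFn (ZMod p) n, P ∈ Smolensky.lowDeg (ZMod p) n d ∧
          ∀ u, u ∉ X → P u = if e u % 3 = r % 3 then (1 : ZMod p) else 0) →
        η₀ * (2 : ℝ) ^ n ≤ ((Finset.univ.filter fun u : Fin n → Bool =>
          e u % 3 = Hegedus.wt u % 3).card : ℝ)) :
    WalkHardFShotsSqrt p := by
  obtain ⟨η₀, hη₀, ε₀, hε₀, c₀, hc₀, n₁, H⟩ := hE
  -- the error parameter of the probabilistic polynomials and the resulting degree constant
  obtain ⟨ε, hεdef⟩ : ∃ ε : ℝ, ε = min (ε₀ / 6) (1 / 2 ^ 101) := ⟨_, rfl⟩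
  have hεpos : 0 < ε := by rw [hεdef]; exact lt_min (by positivity) (by positivity)
  have hεle : ε ≤ 1 / 2 ^ 101 := by rw [hεdef]; exact min_le_right _ _
  have hε100 : ε < 1 / 2 ^ 100 := lt_of_le_of_lt hεle (by norm_num)
  have hε1 : ε < 1 := lt_trans hε100 (by norm_num)
  have h6ε : 6 * ε ≤ ε₀ := by
    have : ε ≤ ε₀ / 6 := by rw [hεdef]; exact min_le_left _ _
    linarith
  obtain ⟨K, hK⟩ : ∃ K : ℝ, K = stvConst p * (Real.sqrt (Real.logb 2 (1 / ε)) + Real.logb 2 (1 / ε)) := ⟨_, rfl⟩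
  have hKnn : 0 ≤ K := by
    rw [hK]
    have hC : 0 ≤ stvConst p := by unfold stvConst; positivity
    have hℓ : 0 ≤ Real.logb 2 (1 / ε) := Real.logb_nonneg (by norm_num) (by rw [le_div_iff₀ hεpos]; linarith)
    positivity
  refine ⟨max (1 - η₀ / 2) (1 / 2), max_lt (by linarith) (by norm_num), fun C => ?_⟩
  obtain ⟨K', hK'⟩ : ∃ K' : ℕ, K' = max 2 (max (max (⌈36 * K ^ 2 / c₀ ^ 2⌉₊) n₁) (⌈2 / η₀⌉₊)) := ⟨_, rfl⟩
  refine ⟨2 ^ K', fun n hn c B y hdeg hshots hbud => ?_⟩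
  have hθ : 1 - η₀ / 2 ≤ max (1 - η₀ / 2) (1 / 2) := le_max_left _ _
  have hθ' : (1 : ℝ) / 2 ≤ max (1 - η₀ / 2) (1 / 2) := le_max_right _ _
  have h2n : (0 : ℝ) < (2 : ℝ) ^ n := by positivity
  have hlogK : K' ≤ Nat.log 2 n := Nat.le_log_of_pow_le (by norm_num) hn
  have hlog2 : 2 ≤ Nat.log 2 n := le_trans (by rw [hK']; exact le_max_left _ _) hlogK
  have hlogn₁ : n₁ ≤ Nat.log 2 n := le_trans (by
    rw [hK']; exact le_trans (le_trans (le_max_right _ _) (le_max_left _ _)) (le_max_right _ _)) hlogK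
  have hlogc : 36 * K ^ 2 / c₀ ^ 2 ≤ (Nat.log 2 n : ℝ) := by
    have h1 : (⌈36 * K ^ 2 / c₀ ^ 2⌉₊ : ℕ) ≤ Nat.log 2 n := le_trans (by
      rw [hK']; exact le_trans (le_trans (le_max_left _ _) (le_max_left _ _)) (le_max_right _ _)) hlogK
    exact le_trans (Nat.le_ceil _) (by exact_mod_cast h1)
  have hlogη : 2 / η₀ ≤ (Nat.log 2 n : ℝ) := by
    have h1 : (⌈2 / η₀⌉₊ : ℕ) ≤ Nat.log 2 n := le_trans (by
      rw [hK']; exact le_trans (le_max_right _ _) (le_max_right _ _)) hlogK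
    exact le_trans (Nat.le_ceil _) (by exact_mod_cast h1)
  -- the win/loss bookkeeping
  have htot : ∀ y' : Fin (n + 1) → (Fin n → Bool) → Bool,
      ((univ.filter fun u : Fin n → Bool => ringWinU c y' u = true).card : ℝ) +
      ((univ.filter fun u : Fin n → Bool => ringWinU c y' u = false).card : ℝ) = (2 : ℝ) ^ n := by
    intro y'
    have h := Finset.card_filter_add_card_filter_not (s := (univ : Finset (Fin n → Bool)))
      (fun u : Fin n → Bool => ringWinU c y' u = true)
    have hneg : (univ.filter fun u : Fin n → Bool => ¬ ringWinU c y' u = true) =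
        univ.filter fun u : Fin n → Bool => ringWinU c y' u = false :=
      Finset.filter_congr fun u _ => by simp
    rw [hneg, card_univ, Fintype.card_fun, Fintype.card_bool, Fintype.card_fin] at h
    exact_mod_cast h
  by_cases hB : B = 0
  · -- no shots at all: nobody ever wins
    have hnone : ∀ u : Fin n → Bool, ringWinU c y u = false := by
      intro u
      unfold ringWinU
      rw [decide_eq_false_iff_not]
      have h0 : (univ.filter fun g : Fin (n + 1) =>
          y g u = true ∧ (c + g.val + walkExp u g.val) % 3 ≠ 0) = ∅ := by
        have h1 := hshots u
        rw [hB, Nat.le_zero, Finset.card_eq_zero] at h1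
        rw [Finset.eq_empty_iff_forall_notMem]
        intro g hg
        rw [mem_filter] at hg
        have : g ∈ (univ.filter fun g : Fin (n + 1) => y g u = true) := by
          rw [mem_filter]; exact ⟨mem_univ _, hg.2.1⟩
        rw [h1] at this
        exact Finset.notMem_empty g this
      rw [h0, card_empty]
      omega
    have hwin0 : (univ.filter fun u : Fin n → Bool => ringWinU c y u = true).card = 0 := by
      rw [Finset.card_eq_zero, Finset.eq_empty_iff_forall_notMem]
      intro u hu
      rw [mem_filter, hnone u] at hu
      exact Bool.false_ne_true hu.2
    rw [hwin0]
    push_cast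
    nlinarith
  · -- `B ≥ 1`: surgery on a quiet interval of length `L = (B+1)·(log₂ n)^{2C+1}`
    have hB1 : 1 ≤ B := Nat.one_le_iff_ne_zero.2 hB
    obtain ⟨L, hL⟩ : ∃ L : ℕ, L = (B + 1) * (Nat.log 2 n) ^ (2 * C + 1) := ⟨_, rfl⟩
    have hLpos : 0 < L := by rw [hL]; positivity
    -- `B·L·log₂ n ≤ n`
    have hBLn : B * L * Nat.log 2 n ≤ n := by
      calc B * L * Nat.log 2 n = B * (B + 1) * (Nat.log 2 n) ^ (2 * C + 2) := by rw [hL]; ring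
        _ ≤ (B * B * 2) * (Nat.log 2 n) ^ (2 * C + 2) :=
            Nat.mul_le_mul_right _ (by nlinarith)
        _ = B ^ 2 * (Nat.log 2 n) ^ (2 * C + 2) * 2 := by ring
        _ ≤ B ^ 2 * (Nat.log 2 n) ^ (2 * C + 2) * Nat.log 2 n := Nat.mul_le_mul_left _ hlog2
        _ = B ^ 2 * (Nat.log 2 n) ^ (2 * C + 3) := by ring
        _ ≤ n := hbud
    have hLn : L ≤ n := le_trans (by
      calc L = 1 * L * 1 := by ring
        _ ≤ B * L * Nat.log 2 n := Nat.mul_le_mul (Nat.mul_le_mul_right _ hB1) (by omega)) hBLn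
    obtain ⟨m, hm⟩ : ∃ m : ℕ, m = n / L := ⟨_, rfl⟩
    have hmB : B * Nat.log 2 n ≤ m := by
      rw [hm, Nat.le_div_iff_mul_le hLpos]
      calc B * Nat.log 2 n * L = B * L * Nat.log 2 n := by ring
        _ ≤ n := hBLn
    have hmpos : 0 < m := lt_of_lt_of_le (by positivity) hmB
    have hmL : m * L ≤ n := by rw [hm]; exact Nat.div_mul_le_self n L
    -- the quiet interval
    obtain ⟨k, hk, hquiet⟩ := exists_quiet_interval L m hmpos y hshots
    have hiL : k * L + L ≤ n := by
      calc k * L + L = (k + 1) * L := by ring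
        _ ≤ m * L := Nat.mul_le_mul_right _ hk
        _ ≤ n := hmL
    -- the operated strategy
    set y' := surgery (k * L) L y with hy'
    have hdeg' : ∀ g, HasDegF p (y' g) ((Nat.log 2 n) ^ C) := fun g => hasDegF_surgery _ _ hdeg g
    have hshots' : ∀ u : Fin n → Bool, (univ.filter fun g : Fin (n + 1) => y' g u = true).card ≤ B :=
      fun u => le_trans (shots_surgery_le _ _ y u) (hshots u)
    have hcf : CutFree (k * L) L y' := cutFree_surgery _ _ y
    -- thresholds for the fibre argument
    have hLn₁ : n₁ ≤ L := by
      refine le_trans hlogn₁ ?_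
      calc Nat.log 2 n = 1 * (Nat.log 2 n) ^ 1 := by ring
        _ ≤ (B + 1) * (Nat.log 2 n) ^ (2 * C + 1) :=
            Nat.mul_le_mul (by omega) (Nat.pow_le_pow_right (by omega) (by omega))
        _ = L := hL.symm
    -- the degree budget: `6·stv·D ≤ 6K√(B+1)·D ≤ c₀ √L`
    have hd : ((6 * (stvDegree p (B + 1) ε * (Nat.log 2 n) ^ C) : ℕ) : ℝ) ≤ c₀ * Real.sqrt L := by
      have hstv := GapFibre.stvDegree_le_sqrt p (B + 1) (by omega) hεpos hε1
      rw [← hK] at hstv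
      have hD0 : (0 : ℝ) ≤ ((Nat.log 2 n) ^ C : ℕ) := by positivity
      have hsq0 : (0 : ℝ) ≤ Real.sqrt ((B + 1 : ℕ) : ℝ) := Real.sqrt_nonneg _
      -- `6K ≤ c₀ √(log₂ n)`
      have h36 : 36 * K ^ 2 ≤ c₀ ^ 2 * (Nat.log 2 n : ℝ) := by
        rw [div_le_iff₀ (by positivity)] at hlogc; linarith
      have h6K : 6 * K ≤ c₀ * Real.sqrt (Nat.log 2 n : ℝ) := by
        have h0 : 0 ≤ c₀ * Real.sqrt (Nat.log 2 n : ℝ) := by positivity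
        have hsq : (6 * K) ^ 2 ≤ (c₀ * Real.sqrt (Nat.log 2 n : ℝ)) ^ 2 := by
          rw [mul_pow, mul_pow, Real.sq_sqrt (by positivity)]; linarith
        nlinarith [sq_nonneg (6 * K - c₀ * Real.sqrt (Nat.log 2 n : ℝ)), hKnn]
      have hLr : Real.sqrt (L : ℝ) = Real.sqrt ((B + 1 : ℕ) : ℝ) * (((Nat.log 2 n) ^ C : ℕ) : ℝ) *
          Real.sqrt (Nat.log 2 n : ℝ) := by
        rw [hL]; push_cast
        rw [show ((B : ℝ) + 1) * (Nat.log 2 n : ℝ) ^ (2 * C + 1) =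
          (((B : ℝ) + 1) * (((Nat.log 2 n : ℝ) ^ C) ^ 2)) * (Nat.log 2 n : ℝ) by ring]
        rw [Real.sqrt_mul (by positivity), Real.sqrt_mul (by positivity), Real.sqrt_sq (by positivity)]
      calc ((6 * (stvDegree p (B + 1) ε * (Nat.log 2 n) ^ C) : ℕ) : ℝ)
          = 6 * ((stvDegree p (B + 1) ε : ℕ) : ℝ) * (((Nat.log 2 n) ^ C : ℕ) : ℝ) := by push_cast; ring
        _ ≤ 6 * (K * Real.sqrt ((B + 1 : ℕ) : ℝ)) * (((Nat.log 2 n) ^ C : ℕ) : ℝ) :=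
            mul_le_mul_of_nonneg_right (mul_le_mul_of_nonneg_left hstv (by norm_num)) hD0
        _ = (6 * K) * (Real.sqrt ((B + 1 : ℕ) : ℝ) * (((Nat.log 2 n) ^ C : ℕ) : ℝ)) := by ring
        _ ≤ (c₀ * Real.sqrt (Nat.log 2 n : ℝ)) * (Real.sqrt ((B + 1 : ℕ) : ℝ) * (((Nat.log 2 n) ^ C : ℕ) : ℝ)) :=
            mul_le_mul_of_nonneg_right h6K (by positivity)
        _ = c₀ * Real.sqrt L := by rw [hLr]; ring
    -- every fibre of `y'` has `≥ η₀·2^L` losses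
    have hfibre : ∀ u : Fin n → Bool, η₀ * (2 : ℝ) ^ L ≤
        ((univ.filter fun z : Fin L → Bool => ringWinU c y' (ow (k * L) L u z) = false).card : ℝ) := by
      intro u
      -- one good realisation of the three level sets on the fibre cube
      have hU := GapFibre.ufam_levelSets (i := k * L) (L := L) (c := c) y' hdeg' hshots' u hεpos hε100
      obtain ⟨P, hPdeg, hPerr⟩ := hU.exists_realisation (Finset.univ : Finset (Fin L → Bool))
      have hXcard := le_trans hPerr (show 6 * ε * (((Finset.univ : Finset (Fin L → Bool)).card : ℕ) : ℝ) ≤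
          ε₀ * (2 : ℝ) ^ L from by
        rw [card_univ, Fintype.card_fun, Fintype.card_bool, Fintype.card_fin]
        push_cast
        exact mul_le_mul_of_nonneg_right h6ε (by positivity))
      have hH := H L hLn₁ (6 * (stvDegree p (B + 1) ε * (Nat.log 2 n) ^ C)) hd
        (namedRes (k * L) L c y' u) _ hXcard (fun r => ⟨P ⟨r % 3, Nat.mod_lt _ (by norm_num)⟩, hPdeg _,
          fun z hz => by
            have hok : P ⟨r % 3, Nat.mod_lt _ (by norm_num)⟩ z =
                boolVal (ZMod p) (decide (namedRes (k * L) L c y' u z % 3 = r % 3)) := by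
              by_contra hne
              apply hz
              simp only [Finset.mem_filter, Finset.mem_univ, true_and]
              exact ⟨⟨r % 3, Nat.mod_lt _ (by norm_num)⟩, hne⟩
            rw [hok]
            unfold boolVal
            by_cases hq : namedRes (k * L) L c y' u z % 3 = r % 3
            · rw [decide_eq_true hq, if_pos rfl, if_pos hq]
            · rw [decide_eq_false hq, if_neg hq]; simp⟩)
      refine le_trans hH ?_
      exact_mod_cast Finset.card_le_card (fun z hz => by
        rw [mem_filter] at hz ⊢
        exact ⟨mem_univ _, ringWinU_ow_eq_false_of_hit hiL c y' hcf u z hz.2⟩)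
    have hcount : (2 : ℝ) ^ L * ((univ.filter fun u : Fin n → Bool => ringWinU c y' u = false).card : ℝ) =
        ∑ u : Fin n → Bool,
          ((univ.filter fun z : Fin L → Bool => ringWinU c y' (ow (k * L) L u z) = false).card : ℝ) := by
      have h := sum_fibre hiL (fun u => if ringWinU c y' u = false then (1 : ℝ) else 0)
      simp only [Finset.sum_boole] at h
      exact h
    have hloss' : η₀ * (2 : ℝ) ^ n ≤
        ((univ.filter fun u : Fin n → Bool => ringWinU c y' u = false).card : ℝ) := by
      have h2L : (0 : ℝ) < (2 : ℝ) ^ L := by positivity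
      refine le_of_mul_le_mul_left ?_ h2L
      rw [hcount]
      calc (2 : ℝ) ^ L * (η₀ * (2 : ℝ) ^ n) = ∑ _u : Fin n → Bool, η₀ * (2 : ℝ) ^ L := by
            rw [Finset.sum_const, Finset.card_univ, Fintype.card_fun, Fintype.card_bool, Fintype.card_fin,
              nsmul_eq_mul]
            push_cast
            ring
        _ ≤ _ := Finset.sum_le_sum fun u _ => hfibre u
    -- losses of `y` ≥ losses of `y'` − (inputs entering the quiet interval)
    have hcompare : (univ.filter fun u : Fin n → Bool => ringWinU c y' u = false).card ≤
        (univ.filter fun u : Fin n → Bool => ringWinU c y u = false).card +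
        (univ.filter fun u : Fin n → Bool =>
          ∃ g : Fin (n + 1), (k * L < g.val ∧ g.val < k * L + L) ∧ y g u = true).card := by
      refine le_trans (Finset.card_le_card fun u hu => ?_) (Finset.card_union_le _ _)
      rw [mem_filter] at hu
      rw [Finset.mem_union, mem_filter, mem_filter]
      by_cases hent : ∃ g : Fin (n + 1), (k * L < g.val ∧ g.val < k * L + L) ∧ y g u = true
      · exact Or.inr ⟨mem_univ _, hent⟩
      · left
        refine ⟨mem_univ _, ?_⟩
        push Not at hent
        rw [← ringWinU_surgery_eq (k * L) L c y u (fun g hg => ?_)]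
        · exact hu.2
        · have := hent g hg
          simpa using this
    have henter : (((univ.filter fun u : Fin n → Bool =>
        ∃ g : Fin (n + 1), (k * L < g.val ∧ g.val < k * L + L) ∧ y g u = true).card : ℕ) : ℝ) ≤
        η₀ / 2 * (2 : ℝ) ^ n := by
      have hq : ((m : ℕ) : ℝ) * ((univ.filter fun u : Fin n → Bool =>
          ∃ g : Fin (n + 1), (k * L < g.val ∧ g.val < k * L + L) ∧ y g u = true).card : ℝ) ≤
          (B : ℝ) * (2 : ℝ) ^ n := by exact_mod_cast hquiet
      have hmr : (B : ℝ) * (Nat.log 2 n : ℝ) ≤ (m : ℝ) := by exact_mod_cast hmB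
      have hBpos : (0 : ℝ) < B := by exact_mod_cast hB1
      have h2B : 2 * (B : ℝ) ≤ η₀ * (m : ℝ) := by
        have h1 : (2 : ℝ) ≤ η₀ * (Nat.log 2 n : ℝ) := by
          rw [div_le_iff₀ hη₀] at hlogη; linarith only [hlogη]
        have h2 : 2 * (B : ℝ) ≤ η₀ * (Nat.log 2 n : ℝ) * (B : ℝ) := by nlinarith only [h1, hBpos]
        have h3 : η₀ * (Nat.log 2 n : ℝ) * (B : ℝ) ≤ η₀ * (m : ℝ) := by nlinarith only [hmr, hη₀]
        linarith only [h2, h3]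
      set E : ℝ := ((univ.filter fun u : Fin n → Bool =>
          ∃ g : Fin (n + 1), (k * L < g.val ∧ g.val < k * L + L) ∧ y g u = true).card : ℝ) with hEdef
      have hE0 : (0 : ℝ) ≤ E := by positivity
      have h4 : 2 * (B : ℝ) * E ≤ η₀ * ((m : ℝ) * E) := by nlinarith only [h2B, hE0]
      have h5 : η₀ * ((m : ℝ) * E) ≤ η₀ * ((B : ℝ) * (2 : ℝ) ^ n) := mul_le_mul_of_nonneg_left hq hη₀.le
      have h6 : (2 * (B : ℝ)) * E ≤ (2 * (B : ℝ)) * (η₀ / 2 * (2 : ℝ) ^ n) := by linarith only [h4, h5]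
      exact le_of_mul_le_mul_left h6 (by linarith only [hBpos])
    have hlossR : ((univ.filter fun u : Fin n → Bool => ringWinU c y' u = false).card : ℝ) ≤
        ((univ.filter fun u : Fin n → Bool => ringWinU c y u = false).card : ℝ) +
        ((univ.filter fun u : Fin n → Bool =>
          ∃ g : Fin (n + 1), (k * L < g.val ∧ g.val < k * L + L) ∧ y g u = true).card : ℝ) := by
      exact_mod_cast hcompare
    have htot_y := htot y
    calc ((univ.filter fun u : Fin n → Bool => ringWinU c y u = true).card : ℝ)
        ≤ (1 - η₀ / 2) * (2 : ℝ) ^ n := by linarith only [htot_y, hloss', hlossR, henter]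
      _ ≤ max (1 - η₀ / 2) (1 / 2) * (2 : ℝ) ^ n := mul_le_mul_of_nonneg_right hθ h2n.le

/-- **Rung R6 `WalkHardFShotsSqrt p` — PROVED for every prime `p ≠ 3`** (over qn-prover g10's robust level-set elimination
`elimLevelSqrtF_robust` and qn-lit g16's STV seed families). -/
theorem walkHardFShotsSqrt (p : ℕ) [Fact p.Prime] (hp3 : p ≠ 3) : WalkHardFShotsSqrt p :=
  walkHardFShotsSqrt_of_elimRobust p (elimLevelSqrtF_robust p hp3)


/-- **Corollary (R4 at the `√n` scale)**: strategies with `s` potentially-active cuts, `s²·(log₂ n)^{2C+3} ≤ n`, ANY geometry,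
win on at most `θ·2ⁿ` inputs (`s` potentially-active cuts ⇒ `≤ s` shots on every input). -/
theorem walkHardFSparseSqrt (p : ℕ) [Fact p.Prime] (hp3 : p ≠ 3) :
    ∃ θ : ℝ, θ < 1 ∧ ∀ C : ℕ, ∃ n₀ : ℕ, ∀ n ≥ n₀, ∀ c : ℕ, ∀ y : Fin (n + 1) → (Fin n → Bool) → Bool,
      (∀ g, HasDegF p (y g) ((Nat.log 2 n) ^ C)) →
      (activeCuts y).card ^ 2 * (Nat.log 2 n) ^ (2 * C + 3) ≤ n →
        ((Finset.univ.filter fun u : Fin n → Bool => ringWinU c y u = true).card : ℝ) ≤ θ * (2 : ℝ) ^ n := by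
  obtain ⟨θ, hθ, h⟩ := walkHardFShotsSqrt p hp3
  refine ⟨θ, hθ, fun C => ?_⟩
  obtain ⟨n₀, hn₀⟩ := h C
  refine ⟨n₀, fun n hn c y hdeg hbud => hn₀ n hn c (activeCuts y).card y hdeg (fun u => ?_) hbud⟩
  refine Finset.card_le_card fun g hg => ?_
  rw [mem_filter] at hg
  unfold activeCuts
  rw [mem_filter]
  exact ⟨mem_univ _, u, hg.2⟩

end Summit.QuantumAdvantage.AdviceFreeQNC0

end
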